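import Summits.PneNP.PneNP.Theses.MonochromaticLines
import Summits.PneNP.PneNP.Theorems.MonochromaticLinesCollisionReduces
import Summits.PneNP.PneNP.Theorems.MonochromaticLinesMonoLineQueryLowerBound
import Summits.PneNP.PneNP.Theorems.MonochromaticLinesClassBridge
import Summits.PneNP.PneNP.Theorems.MonochromaticLinesMonoLineTotal
import Summits.PneNP.PneNP.Theorems.MonochromaticLinesMonoLineCheckable
import Literature.Computability.Complexity.SearchToDecision
import Literature.Computability.Complexity.TM2PassThrough

/-!
# Crux `MonoLineHard` (stmt-PneNP-11755) — decomposition probes (crux-strategist census evidence)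

BC2-redirect asks for a typed decomposition `X₁ ∧ … ∧ X_k → MonoLineHard` with (a) every piece load-bearing,
(b) a proved NON-trivial assembly, (c) no piece equivalent to the crux `X := MonoLineHard` or to the summit `S := PneNP`.
This file TYPES the candidate pieces of the decompositions D1–D4 of `STRATEGY-CENSUS.md` over a `κ`-parametrised copy
of the route vocabulary (`κ n` = number of colour bits; the route has `κ n = n / 10`, `n₀ = 200`) and PROVES the facts
that disqualify them:

* `monoLineHardK_route`      : the parametrised statement at `(· / 10, 200)` is the crux, definitionally.
* `d1_collisionHard_implies_crux` : D1's piece `CollisionHard` alone gives `X` through the LANDED support item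
  `CollisionReduces` — violates (a)/(c) (the piece is `PWPP ⊄ FP`-strength, ≥ X).
* `d3_seam`                  : D3's assembly (`hardness at 3n/25 colour bits` ∧ `colour compression` → X) is a one-line
  modus tollens — violates (b); and `summitStrength` shows its hardness piece is summit-or-harder — violates (c).
* `d4_whiteToBlack_implies_crux` : D4's transfer piece is ≥ X given the LANDED black-box bound — violates (c).
* `summitStrength`           : for EVERY colour budget `κ ≤ id` and threshold `n₀`, totality + P-checkability turn
  `MonoLineHardK κ n₀` into a proof of `PneNP` (the route's Assembly argument, re-run generically): every
  "MONO-LINE-type problem ∉ FP" piece is summit-or-harder, so no piece of an admissible decomposition may be a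
  TFNP-hardness statement.
* `parity_obstruction`, `resource_seam` : the two propositional identities behind §Decomposition of the census.
-/

set_option linter.dupNamespace false
set_option autoImplicit false

namespace Summit.PneNP.PneNP.Cruxes.MonoLineHard.Census

open Polynomial
open Literature.Computability.Complexity Computability
open Summit.PneNP.PneNP.Theses.MonochromaticLines

/-! ## Shared vocabulary, parametrised by the colour budget `κ` -/

/-- Pairwise-distinct digitwise affine line `x + y + z ≡ 0 (mod 3)` below `3ⁿ` (verbatim from the route file). -/
def IsLine (n x y z : ℕ) : Prop :=
  x < 3 ^ n ∧ y < 3 ^ n ∧ z < 3 ^ n ∧ x ≠ y ∧ y ≠ z ∧ x ≠ z ∧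
    ∀ l : ℕ, l < n → (x / 3 ^ l % 3 + y / 3 ^ l % 3 + z / 3 ^ l % 3) % 3 = 0

/-- Instances with `κ n` colour circuits on `2n` inputs. -/
abbrev Inst (κ : ℕ → ℕ) : Type := Σ n : ℕ, (Fin (κ n) → Circuit (Fin (2 * n)))

/-- The colouring read off the circuits. -/
def col (κ : ℕ → ℕ) (I : Inst κ) (x : ℕ) : Fin (κ I.1) → Bool :=
  fun j => (I.2 j).eval (fun i : Fin (2 * I.1) => decide (x / 3 ^ ((i : ℕ) / 2) % 3 = (i : ℕ) % 2 + 1))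

/-- Validity: dimension at least `n₀`, fan-in at most two. -/
def Valid (κ : ℕ → ℕ) (n₀ : ℕ) (I : Inst κ) : Prop :=
  n₀ ≤ I.1 ∧ ∀ j : Fin (κ I.1), ∀ g ∈ (I.2 j).gates, g.arity ≤ 2

/-- Decoding a solution string into a triple of points. -/
def dec (w : List Bool) : ℕ × ℕ × ℕ :=
  (decodeNat (boolUnpair w).1, decodeNat (boolUnpair (boolUnpair w).2).1,
    decodeNat (boolUnpair (boolUnpair w).2).2)

/-- `w` codes a monochromatic line of `I`. -/
def SolStr (κ : ℕ → ℕ) (I : Inst κ) (w : List Bool) : Prop :=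
  IsLine I.1 (dec w).1 (dec w).2.1 (dec w).2.2 ∧ col κ I (dec w).1 = col κ I (dec w).2.1 ∧
    col κ I (dec w).2.1 = col κ I (dec w).2.2

/-- Wire code. -/
def wire (m : ℕ) (w : Fin m ⊕ ℕ) : List Bool :=
  Sum.elim (fun i : Fin m => false :: encodeNat (i : ℕ)) (fun j : ℕ => true :: encodeNat j) w

/-- Gate-list code of a circuit. -/
def code (m : ℕ) (C : Circuit (Fin m)) : List Bool :=
  boolPair ((C.gates.map fun g => boolPair (Literature.Computability.MetaComplexity.truthTable g.op)
    ((List.ofFn fun a : Fin g.arity => wire m (g.args a)).foldr boolPair [])).foldr boolPair [])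
    (wire m C.output)

/-- Instance code: unary `n`, then the circuit codes. -/
def encI (κ : ℕ → ℕ) (I : Inst κ) : List Bool :=
  boolPair (unaryEncodeNat I.1) ((List.ofFn fun j : Fin (κ I.1) => code (2 * I.1) (I.2 j)).foldr boolPair [])

/-- `InFP κ n₀`: MONO-LINE with colour budget `κ` and validity threshold `n₀` has a polynomial-time solver. -/
def InFP (κ : ℕ → ℕ) (n₀ : ℕ) : Prop :=
  ∃ f : Inst κ → List Bool, (∀ I, Valid κ n₀ I → SolStr κ I (f I)) ∧
    PolyTimeComputable (encI κ) (id : List Bool → List Bool) f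

/-- The `κ`-parametrised hardness statement (the colour DIAL); `MonoLineHardK (· / 10) 200` is the crux. -/
def MonoLineHardK (κ : ℕ → ℕ) (n₀ : ℕ) : Prop := ¬ InFP κ n₀

/-- The crux is the dial at `κ n = n / 10`, `n₀ = 200` — definitionally. -/
theorem monoLineHardK_route : MonoLineHardK (fun n => n / 10) 200 ↔ MonoLineHard := Iff.rfl

/-! ## D1 — the PWPP seam `CollisionHard ∧ CollisionReduces → X` -/

/-- `w` codes a collision `x ≠ y < 3ⁿ`, `C(x) = C(y)` of the instance circuits read as a hash. -/
def CollStr (κ : ℕ → ℕ) (I : Inst κ) (w : List Bool) : Prop :=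
  (dec w).1 < 3 ^ I.1 ∧ (dec w).2.1 < 3 ^ I.1 ∧ (dec w).1 ≠ (dec w).2.1 ∧ col κ I (dec w).1 = col κ I (dec w).2.1

/-- Piece X₁ of D1: worst-case collision finding for the instance circuits (hash `[3ⁿ] → [2^{κ n}]`) is not in FP. -/
def CollisionHard (κ : ℕ → ℕ) (n₀ : ℕ) : Prop :=
  ¬ ∃ g : Inst κ → List Bool, (∀ I, Valid κ n₀ I → CollStr κ I (g I)) ∧
    PolyTimeComputable (encI κ) (id : List Bool → List Bool) g

/-- The landed support item `CollisionReduces`, re-read over the parametrised vocabulary (definitionally). -/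
theorem collisionReduces_route :
    (InFP (fun n => n / 10) 200 → ∃ g : Inst (fun n => n / 10) → List Bool,
      (∀ I, Valid (fun n => n / 10) 200 I → CollStr (fun n => n / 10) I (g I)) ∧
      PolyTimeComputable (encI fun n => n / 10) (id : List Bool → List Bool) g) ↔ CollisionReduces :=
  Iff.rfl

/-- **D1 violates (a)/(c).** The piece `CollisionHard` ALONE implies the crux through the landed theorem
`monochromaticLines_collisionReduces_proof`; the other piece is not load-bearing and `CollisionHard ≥ X`. -/
theorem d1_collisionHard_implies_crux : CollisionHard (fun n => n / 10) 200 → MonoLineHard := fun hC hX =>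
  hC (collisionReduces_route.mpr Summit.PneNP.PneNP.Theorems.monochromaticLines_collisionReduces_proof hX)

/-! ## D3 — the colour dial `MonoLineHardK (3n/25) ∧ ColourCompression → X` -/

/-- Piece X₂ of D3 (open, purely algorithmic): colour compression — a polynomial-time solver at budget `n/10`
yields one at budget `3n/25` (totality needs `k < 0.12285·n − 1.585`; `3n/25 = 0.12 n` qualifies for `n ≥ 556`, we take `600`). -/
def ColourCompression : Prop := InFP (fun n => n / 10) 200 → InFP (fun n => 3 * n / 25) 600

/-- **D3 violates (b).** The assembly is modus tollens — a one-line seam. -/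
theorem d3_seam : MonoLineHardK (fun n => 3 * n / 25) 600 → ColourCompression → MonoLineHard :=
  fun hA hB hX => hA (hB hX)

/-! ## D4 — white-box-to-black-box transfer `QueryLowerBound ∧ WhiteToBlack → X` -/

/-- Query runs of an adaptive strategy (verbatim from the route file, at budget `n/10`). -/
def run (n : ℕ) (q : List (Fin (n / 10) → Bool) → ℕ) (c : ℕ → (Fin (n / 10) → Bool)) (d : ℕ) :
    List (Fin (n / 10) → Bool) :=
  @Nat.rec (fun _ => List (Fin (n / 10) → Bool)) [] (fun _ acc => acc ++ [c (q acc)]) d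

/-- Monochromatic output triple (verbatim from the route file). -/
def Mono (n : ℕ) (c : ℕ → (Fin (n / 10) → Bool)) (s : ℕ × ℕ × ℕ) : Prop :=
  IsLine n s.1 s.2.1 s.2.2 ∧ c s.1 = c s.2.1 ∧ c s.2.1 = c s.2.2

/-- The landed black-box bound, re-read over this vocabulary (definitionally). -/
theorem queryLowerBound_route :
    (∀ n : ℕ, 10 ≤ n → ∀ d : ℕ, d < 2 ^ (n / 10) → ∀ (q : List (Fin (n / 10) → Bool) → ℕ)
      (out : List (Fin (n / 10) → Bool) → ℕ × ℕ × ℕ), ∃ c : ℕ → (Fin (n / 10) → Bool), ¬ Mono n c (out (run n q c d)))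
      ↔ MonoLineQueryLowerBound :=
  Iff.rfl

/-- Piece X₂ of D4 ("white-box collapses to black-box"): a polynomial-time solver yields, at some dimension `n ≥ 10`,
a deterministic adaptive strategy with fewer than `2^{⌊n/10⌋}` colour queries that is correct on EVERY colouring. -/
def WhiteToBlack : Prop :=
  InFP (fun n => n / 10) 200 → ∃ n : ℕ, 10 ≤ n ∧ ∃ d : ℕ, d < 2 ^ (n / 10) ∧
    ∃ (q : List (Fin (n / 10) → Bool) → ℕ) (out : List (Fin (n / 10) → Bool) → ℕ × ℕ × ℕ),
      ∀ c : ℕ → (Fin (n / 10) → Bool), Mono n c (out (run n q c d))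

/-- **D4 violates (c).** Given the landed `MonoLineQueryLowerBound`, the transfer piece alone implies the crux
(so it is `X` in costume relative to the tree). -/
theorem d4_whiteToBlack_implies_crux : WhiteToBlack → MonoLineHard := by
  intro hW hX
  obtain ⟨n, hn, d, hd, q, out, hall⟩ := hW hX
  obtain ⟨c, hc⟩ := queryLowerBound_route.mpr
    Summit.PneNP.PneNP.Theorems.monochromaticLines_monoLineQueryLowerBound_proof n hn d hd q out
  exact hc (hall c)

/-! ## Every dial point is summit-or-harder (the route's Assembly, generically in `κ`) -/

/-- Totality at budget `κ`, threshold `n₀`. -/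
def TotalK (κ : ℕ → ℕ) (n₀ : ℕ) : Prop :=
  ∀ n : ℕ, n₀ ≤ n → ∀ c : ℕ → (Fin (κ n) → Bool), ∃ x y z : ℕ, IsLine n x y z ∧ c x = c y ∧ c y = c z

/-- P-checkability of solutions at budget `κ`, threshold `n₀`. -/
def CheckableK (κ : ℕ → ℕ) (n₀ : ℕ) : Prop :=
  ∃ R ∈ Classes.P, ∀ I : Inst κ, Valid κ n₀ I → ∀ w : List Bool, boolPair (encI κ I) w ∈ R ↔ SolStr κ I w

theorem totalK_route : TotalK (fun n => n / 10) 200 ↔ MonoLineTotal := Iff.rfl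

theorem checkableK_route : CheckableK (fun n => n / 10) 200 ↔ MonoLineCheckable := Iff.rfl

/-- Generic Assembly: totality + checkability + `NP ⊆ P` give a polynomial-time solver at ANY budget `κ`
(search-to-decision, Arora–Barak Thm 2.18, witness bound `10·|x| + 20`). [cite: AroraBarakCC2009, Thm. 2.18] -/
theorem assemblyK (κ : ℕ → ℕ) (n₀ : ℕ) (hT : TotalK κ n₀) (hC : CheckableK κ n₀)
    (hNP : Nondeterministic.NP ⊆ Classes.P) : InFP κ n₀ := by
  obtain ⟨R, hR, hRiff⟩ := hC
  obtain ⟨g, hg, hspec⟩ := exists_searchFn_of_NP_subset_P hNP hR (10 * X + 20)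
  refine ⟨fun I => g (encI κ I), fun I hI => ?_, ?_⟩
  · obtain ⟨x, y, z, hline, hc1, hc2⟩ := hT I.1 hI.1 (col κ I)
    set w : List Bool := boolPair (encodeNat x) (boolPair (encodeNat y) (encodeNat z)) with hw
    have hsol : SolStr κ I w := by
      simp only [SolStr, dec, hw, boolUnpair_boolPair, decode_encodeNat]
      exact ⟨hline, hc1, hc2⟩
    have hlog : ∀ t : ℕ, t < 3 ^ I.1 → (encodeNat t).length ≤ 2 * I.1 + 1 := by
      intro t ht
      refine (TM2Pass.length_encodeNat_le t).trans ?_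
      have h34 : 3 ^ I.1 ≤ 2 ^ (2 * I.1) := by
        rw [pow_mul]
        exact Nat.pow_le_pow_left (by norm_num) _
      rcases Nat.eq_zero_or_pos t with rfl | htpos
      · simp
      · have : Nat.log 2 t < 2 * I.1 := Nat.log_lt_of_lt_pow htpos.ne' (ht.trans_le h34)
        omega
    obtain ⟨hx, hy, hz, -⟩ := hline
    have hlen : w.length ≤ (10 * X + 20 : Polynomial ℕ).eval (encI κ I).length := by
      have ex := hlog x hx
      have ey := hlog y hy
      have ez := hlog z hz
      have hI1 : 2 * I.1 ≤ (encI κ I).length := by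
        simp only [encI, length_boolPair]
        have := unary_decode_encode_nat I.1
        change (unaryEncodeNat I.1).length = I.1 at this
        omega
      simp only [hw, length_boolPair, eval_add, eval_mul, eval_ofNat, eval_X]
      omega
    have hmem : boolPair (encI κ I) w ∈ R := (hRiff I hI w).2 hsol
    have hres := hspec (encI κ I) ⟨w, hlen, hmem⟩
    exact (hRiff I hI _).1 hres.2
  · obtain ⟨p, M, hM⟩ := hg
    exact ⟨p, M, fun I => hM (encI κ I)⟩

/-- **Every dial point is summit-or-harder.** For any budget `κ` and threshold `n₀` at which MONO-LINE is total
and P-checkable, the hardness statement `MonoLineHardK κ n₀` implies `PneNP` (uses the landed `ClassBridge`).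
At `(· / 10, 200)` both hypotheses are landed and this is the route's `closes`; at `(3 · / 25, 600)` they are
provable the same way — so D3's hardness piece violates (c). -/
theorem summitStrength (κ : ℕ → ℕ) (n₀ : ℕ) (hT : TotalK κ n₀) (hC : CheckableK κ n₀)
    (hX : MonoLineHardK κ n₀) : PneNP :=
  Classical.byContradiction fun hne =>
    hX (assemblyK κ n₀ hT hC (Summit.PneNP.PneNP.Theorems.monochromaticLines_classBridge_proof
      fun L hL => Classical.byContradiction fun hP => hne ⟨L, hL, hP⟩))

/-- Sanity: at the route's dial point the two hypotheses are landed, and `summitStrength` re-derives `closes`. -/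
theorem summitStrength_route (hX : MonoLineHard) : PneNP :=
  summitStrength (fun n => n / 10) 200
    (totalK_route.mpr Summit.PneNP.PneNP.Theorems.monochromaticLines_monoLineTotal_proof)
    (checkableK_route.mpr Summit.PneNP.PneNP.Theorems.monochromaticLines_monoLineCheckable_proof)
    (monoLineHardK_route.mpr hX)

/-! ## The two propositional identities behind the census -/

/-- **Parity obstruction.** If two pieces assemble to the summit and one of them is a known consequence of
`P = NP`, the other piece is summit-or-harder. Hence both pieces of an admissible split must have UNDETERMINED
status in the `P = NP` world (no TFNP-hardness piece, no crypto piece, no `NEXP ⊄ P/poly`-type piece). -/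
theorem parity_obstruction (A B S PeqNP : Prop) (hS : S ↔ ¬ PeqNP) (glue : A → B → S) (hA : PeqNP → A) :
    B → S :=
  fun hB => hS.mpr fun hp => hS.mp (glue (hA hp) hB) hp

/-- **Resource seam.** Splitting `X = ¬U` (`U` = "ML ∈ FP") as "ML ∉ 𝒞" ∧ "ML ∈ FP → ML ∈ 𝒞" for a subclass
`𝒞 ⊆ FP` (`V → U`) is the tautology `¬U ↔ ¬V ∧ (U → V)`: a propositional seam, never a decomposition. -/
theorem resource_seam (U V : Prop) (hVU : V → U) : (¬ V ∧ (U → V)) ↔ ¬ U :=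
  ⟨fun h hU => h.1 (h.2 hU), fun h => ⟨fun hV => h (hVU hV), fun hU => (h hU).elim⟩⟩

end Summit.PneNP.PneNP.Cruxes.MonoLineHard.Census
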